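import Literature.MathematicalPhysics.QuantumFieldTheory.Balaban1983to89.B5Hk163TorusHolderRate
import Literature.MathematicalPhysics.QuantumFieldTheory.Balaban1983to89.Beta.FluctuationProjection

/-!
# `BalabanUV.Beta.GAN24.HkGradientSecant` — binder row G-an2-4 ∕ (CONV-C), route R7 (ρ3) GRADIENT PART, road P2: at ONE level `n`,
# the GRADIENT kernel `∂_νH_k` of Bałaban's minimiser `H_k` (b05's typed torus operator `B5Hk163Torus.HkOp`, gradient kernel
# `B5Hk163TorusHolder.dker`) is within `CHR(d,α)·(h∕n)^α × (decay)` of the SECANT SLOPE of `H_k` over `h` fine steps in direction `ν`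
# inside a block — the one-level half of the secant interpolation that turns a VALUE one-step law into a GRADIENT one-step law

NOT IN PRINT; OUR PROOF ATTEMPT (unit `b2b-balaban-gan24-p2`, gen 31 = prover-b2b-balaban-gan24-p2-g31-0, road-P2 chair of row G-an2-4;
CRUX TEAM (2) under the ruling «YM REDIRECT TOWARDS THE SUMMIT», 2026-08-21).  HONEST FRAMING (cell contract, verbatim): «discharging
`BetaPertH` makes Bałaban's UV stability UNCONDITIONAL — a real constructive-QFT result; it is NOT the continuum limit and NOT the Clay
problem.»  HONEST DEPENDENCY (verbatim): «continuum YM on T⁴ ⇐ BetaPertH ∧ nine spine estimates (0/9 proved); BetaPertH ⇐ (D1) ∧ (D4) ∧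
CAP+tail; G-an2-4 gates asym, D1 and NE2/3/4.»  ABSOLUTE RULE: nothing printed is a hypothesis; no `def … : Prop`, no `sorry`; [folklore]
real analysis over TREE theorems BY NAME (b05's `B5Hk163TorusHolderRate.norm_dker_sub_le_rate` — the decaying Hölder bound of `∂_νH_k` at
the full rate — and the block bookkeeping `Beta.FluctuationProjection.bpt_add_tstep_of_lt`).

## Why (the interpolation behind `HkGradientKingOneStep`, next file)

Route R7 of `HOME/beta/ROUTES-GAN24.md` (v10, §2 R7 S3 (ρ3)) lists the one-step rate of the GRADIENT leg `∂_νH_k` as «TO PROVE (S–M)»; the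
VALUE leg's one-step law against King's block parent is gan24-p3-g27's `HkKingOneStep.norm_HkOp_king_sub_le` (rate `KH1(d)∕N` with decay),
and b05 holds a UNIFORM decaying `α`-Hölder bound for the gradient kernel.  A function whose values move by `ε` and whose derivative is
`α`-Hölder with constant `A` has its derivative pinned to within `A·ℓ^α + 2ε∕ℓ` by secants of length `ℓ`; on the lattice the «derivative» IS a
difference quotient and the secant over `h` steps is the AVERAGE of `h` consecutive difference quotients, so the one-level statement is exact
bookkeeping plus the Hölder bound:
 * §1 `norm_sub_secant_le` — the abstract averaging lemma: if `c·(φ(t+1) − φ(t)) = D(t)` for `t < h` and `‖D(t) − D(t₀)‖ ≤ A` for `t < h`,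
   then `‖D(t₀) − (c∕h)·(φ(h) − φ(0))‖ ≤ A` (`h ≥ 1`).
 * §2 the in-block ray `rayPt n M x′ c ν t = n·x̄′ + c + t·e_ν` (`c_ν + t < n`): `rayPt_succ` (consecutive points differ by `e_ν`),
   `rayPt_eq_add_toT` (two ray points differ by the integer vector `(t − t₀)·e_ν`), `supNorm_raySub_le`;
   `hker_ray_step` (`n·(hker(P(t+1)) − hker(P t)) = dker(P t)`); **`norm_dker_ray_sub_le`**: for `t, t₀ ≤ h`,
   `‖dker(P t) − dker(P t₀)‖ ≤ CHR(d,α)·(h∕n)^α·e^{−δ|x′−x|_T}` (`norm_dker_sub_le_rate` BY NAME, both points in the block `x′`).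
 * §3 **`norm_dker_sub_secant_le`**: for `1 ≤ h`, `c_ν + h < n`, `t₀ ≤ h`, `0 ≤ α < 1`,
   `‖∂_νH_n((P t₀, μ),(x̄,λ)) − (n∕h)·(H_n((P h, μ),(x̄,λ)) − H_n((P 0, μ),(x̄,λ)))‖ ≤ CHR(d,α)·(h∕n)^α·e^{−(κ₁₆₃(d+1)∕(d+1))|x′−x|_T}`.
HONEST SCOPE.  Torus model of the b05 lineage (`U = 1`, `m² = 0`, dimension `d+1 ≥ 1`), every `n ≥ 1`, every period vector; constants b05's
(`CHR(d,α)`, diverging as `α ↑ 1`); no rate between levels is claimed HERE (that is the next file).  NOT (CONV-C), NEVER «G-an2-4 closed», NOT NE2,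
NOT D1, NOT BetaPertH, NOT continuum, NOT Clay.  Text locations only: [Balaban1984PropagatorsI] (1.63) p. 28, p. 29 lines 1–2 (the Hölder claim).
-/

noncomputable section

open scoped BigOperators
open Finset

namespace Summit.QuantumFields.BalabanUV.Beta.GAN24.HkGradientSecant

open Literature.MathematicalPhysics.QuantumFieldTheory.Balaban1983to89
open Literature.MathematicalPhysics.QuantumFieldTheory.Balaban1983to89.B5Prop11Plancherel (Tor fine unitVec)
open Literature.MathematicalPhysics.QuantumFieldTheory.Balaban1983to89.B4ContourShift (supNorm supNorm_nonneg abs_le_supNorm)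
open Literature.MathematicalPhysics.QuantumFieldTheory.Balaban1983to89.B4TorusKernel (periodConst)
open Literature.MathematicalPhysics.QuantumFieldTheory.Balaban1983to89.B4TorusKernel.MultiPeriod (torusSupNorm)
open Literature.MathematicalPhysics.QuantumFieldTheory.Balaban1983to89.B5Block118 (bpt tstep tstep_succ tstep_zero)
open Literature.MathematicalPhysics.QuantumFieldTheory.Balaban1983to89.B6LowerBound2153Torus (toT)
open Literature.MathematicalPhysics.QuantumFieldTheory.Balaban1983to89.B5Hk163Strip (kappa163 kappa163_pos)
open Literature.MathematicalPhysics.QuantumFieldTheory.Balaban1983to89.B5Hk163Torus (hker HkOp)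
open Literature.MathematicalPhysics.QuantumFieldTheory.Balaban1983to89.B5Hk163TorusHolder (dker)
open Literature.MathematicalPhysics.QuantumFieldTheory.Balaban1983to89.B5Hk163TorusHolderRate (CHR CHR_nonneg norm_dker_sub_le_rate)
open Literature.MathematicalPhysics.QuantumFieldTheory.Balaban1983to89.Beta.FluctuationProjection (bpt_add_tstep_of_lt)

variable {d : ℕ}

/-! ## §1 The abstract averaging lemma -/

/-- telescoping: `Σ_{t<h} c·(φ(t+1) − φ t) = c·(φ h − φ 0)`. [folklore] -/
theorem sum_range_mul_sub (φ : ℕ → ℂ) (c : ℂ) (h : ℕ) :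
    ∑ t ∈ range h, c * (φ (t + 1) - φ t) = c * (φ h - φ 0) := by
  rw [← mul_sum, sum_range_sub]

/-- **THE AVERAGING LEMMA**: if `c·(φ(t+1) − φ t) = D t` for `t < h` (`h ≥ 1`) and `‖D t − D t₀‖ ≤ A` for all `t < h`, then the difference
quotient at `t₀` is within `A` of the secant slope over `[0, h]`: `‖D t₀ − (c∕h)·(φ h − φ 0)‖ ≤ A` — because the secant slope is the MEAN of the
`h` difference quotients `D 0, …, D (h−1)`. [folklore] -/
theorem norm_sub_secant_le (φ : ℕ → ℂ) (D : ℕ → ℂ) (c : ℂ) {h : ℕ} (hh : 1 ≤ h) (t₀ : ℕ) {A : ℝ}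
    (hD : ∀ t < h, c * (φ (t + 1) - φ t) = D t) (hA : ∀ t < h, ‖D t - D t₀‖ ≤ A) :
    ‖D t₀ - c / h * (φ h - φ 0)‖ ≤ A := by
  have hh0 : (h : ℂ) ≠ 0 := by exact_mod_cast (Nat.one_le_iff_ne_zero.mp hh)
  have hhR : (0 : ℝ) < h := by exact_mod_cast hh
  have hsum : c * (φ h - φ 0) = ∑ t ∈ range h, D t := by
    rw [← sum_range_mul_sub]; exact sum_congr rfl fun t ht => hD t (mem_range.mp ht)
  have hkey : D t₀ - c / h * (φ h - φ 0) = (h : ℂ)⁻¹ * ∑ t ∈ range h, (D t₀ - D t) := by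
    rw [sum_sub_distrib, sum_const, card_range, nsmul_eq_mul, ← hsum]
    field_simp
  rw [hkey, norm_mul, norm_inv, Complex.norm_natCast]
  calc (h : ℝ)⁻¹ * ‖∑ t ∈ range h, (D t₀ - D t)‖ ≤ (h : ℝ)⁻¹ * ∑ t ∈ range h, ‖D t₀ - D t‖ :=
        mul_le_mul_of_nonneg_left (norm_sum_le _ _) (inv_nonneg.mpr hhR.le)
    _ ≤ (h : ℝ)⁻¹ * ∑ _t ∈ range h, A := by
        refine mul_le_mul_of_nonneg_left (sum_le_sum fun t ht => ?_) (inv_nonneg.mpr hhR.le)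
        rw [norm_sub_rev]; exact hA t (mem_range.mp ht)
    _ = A := by rw [sum_const, card_range, nsmul_eq_mul]; field_simp

/-! ## §2 The in-block ray and the Hölder input -/

section Ray

variable (n : ℕ) (M : Fin (d + 1) → ℕ)

/-- the offset `c` moved `t` steps in direction `ν` (a valid offset when `c_ν + t < n`; junk value `c` otherwise — never used). [folklore] -/
def rayOff (c : Fin (d + 1) → Fin n) (ν : Fin (d + 1)) (t : ℕ) : Fin (d + 1) → Fin n :=
  if ht : (c ν : ℕ) + t < n then Function.update c ν ⟨(c ν : ℕ) + t, ht⟩ else c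

/-- **the in-block ray**: `rayPt x′ c ν t = n·x̄′ + c + t·e_ν` as a point of the fine torus, for `c_ν + t < n`. [folklore] -/
def rayPt (x' : Fin (d + 1) → ℤ) (c : Fin (d + 1) → Fin n) (ν : Fin (d + 1)) (t : ℕ) : Tor (fine n M) :=
  bpt n M (toT M x') (rayOff n c ν t)

/-- `rayPt t = n·x̄′ + c + tstep ν t` for `c_ν + t < n`. [folklore] -/
theorem rayPt_eq (x' : Fin (d + 1) → ℤ) (c : Fin (d + 1) → Fin n) (ν : Fin (d + 1)) (t : ℕ) (ht : (c ν : ℕ) + t < n) :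
    rayPt n M x' c ν t = bpt n M (toT M x') c + tstep (fine n M) ν t := by
  rw [rayPt, rayOff, dif_pos ht, bpt_add_tstep_of_lt]

/-- `rayPt 0 = n·x̄′ + c`. [folklore] -/
theorem rayPt_zero (x' : Fin (d + 1) → ℤ) (c : Fin (d + 1) → Fin n) (ν : Fin (d + 1)) :
    rayPt n M x' c ν 0 = bpt n M (toT M x') c := by
  rw [rayPt_eq n M x' c ν 0 (by simp), tstep_zero, add_zero]

/-- consecutive ray points differ by the unit vector `e_ν`. [folklore] -/
theorem rayPt_succ (x' : Fin (d + 1) → ℤ) (c : Fin (d + 1) → Fin n) (ν : Fin (d + 1)) (t : ℕ) (ht : (c ν : ℕ) + (t + 1) < n) :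
    rayPt n M x' c ν (t + 1) = rayPt n M x' c ν t + unitVec (fine n M) ν := by
  rw [rayPt_eq n M x' c ν (t + 1) ht, rayPt_eq n M x' c ν t (by omega), tstep_succ, add_assoc]

/-- the integer displacement `(t − t₀)·e_ν`. [folklore] -/
def rayVec (ν : Fin (d + 1)) (t t₀ : ℕ) : Fin (d + 1) → ℤ := fun i => if i = ν then (t : ℤ) - t₀ else 0

/-- `tstep ν t − tstep ν t₀ = toT ((t − t₀)·e_ν)` on the fine torus. [folklore] -/
theorem tstep_sub_tstep (ν : Fin (d + 1)) (t t₀ : ℕ) :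
    tstep (fine n M) ν t - tstep (fine n M) ν t₀ = toT (fine n M) (rayVec ν t t₀) := by
  funext i
  simp only [tstep, rayVec, toT, Pi.sub_apply]
  by_cases hi : i = ν
  · simp [hi]
  · simp [hi]

/-- two ray points differ by `toT ((t − t₀)·e_ν)`. [folklore] -/
theorem rayPt_eq_add_toT (x' : Fin (d + 1) → ℤ) (c : Fin (d + 1) → Fin n) (ν : Fin (d + 1)) (t t₀ : ℕ)
    (ht : (c ν : ℕ) + t < n) (ht₀ : (c ν : ℕ) + t₀ < n) :
    rayPt n M x' c ν t = rayPt n M x' c ν t₀ + toT (fine n M) (rayVec ν t t₀) := by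
  rw [rayPt_eq n M x' c ν t ht, rayPt_eq n M x' c ν t₀ ht₀, ← tstep_sub_tstep, add_assoc, add_sub_cancel]

/-- `|(t − t₀)·e_ν|_∞ ≤ h` for `t, t₀ ≤ h`. [folklore] -/
theorem supNorm_rayVec_le (ν : Fin (d + 1)) {t t₀ h : ℕ} (ht : t ≤ h) (ht₀ : t₀ ≤ h) : supNorm (rayVec ν t t₀) ≤ h := by
  unfold supNorm
  refine Finset.sup'_le _ _ fun i _ => ?_
  by_cases hi : i = ν
  · simp only [rayVec, hi, if_true]
    have h1 : |((t : ℤ) - t₀)| ≤ h := by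
      rw [abs_le]; constructor <;> omega
    exact_mod_cast h1
  · simp only [rayVec, hi, if_false, abs_zero, Int.cast_zero]
    exact Nat.cast_nonneg h

variable [NeZero n] [hM : ∀ μ, NeZero (M μ)]

/-- **one step along the ray is the gradient kernel**: `n·(hker(P(t+1)) − hker(P t)) = dker(P t)` for `c_ν + t + 1 < n`. [folklore] -/
theorem hker_ray_step (μ lam ν : Fin (d + 1)) (x' x : Fin (d + 1) → ℤ) (c : Fin (d + 1) → Fin n) (t : ℕ)
    (ht : (c ν : ℕ) + (t + 1) < n) :
    (n : ℂ) * (hker n M μ lam (rayPt n M x' c ν (t + 1)) (toT M x) - hker n M μ lam (rayPt n M x' c ν t) (toT M x))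
      = dker n M μ lam ν (rayPt n M x' c ν t) (toT M x) := by
  rw [rayPt_succ n M x' c ν t ht, dker]

/-- **THE HÖLDER INPUT ALONG THE RAY** (b05's full-rate decaying Hölder bound BY NAME): for `t, t₀ ≤ h` with `c_ν + h < n`,
`‖dker(P t) − dker(P t₀)‖ ≤ CHR(d,α)·(h∕n)^α·e^{−(κ₁₆₃(d+1)∕(d+1))·|x′−x|_T}`. [folklore] -/
theorem norm_dker_ray_sub_le (μ lam ν : Fin (d + 1)) (x' x : Fin (d + 1) → ℤ) (c : Fin (d + 1) → Fin n) {h t t₀ : ℕ}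
    (hch : (c ν : ℕ) + h < n) (ht : t ≤ h) (ht₀ : t₀ ≤ h) {α : ℝ} (hα0 : 0 ≤ α) (hα1 : α < 1) :
    ‖dker n M μ lam ν (rayPt n M x' c ν t) (toT M x) - dker n M μ lam ν (rayPt n M x' c ν t₀) (toT M x)‖
      ≤ CHR d α * ((h : ℝ) / n) ^ α * Real.exp (-(kappa163 (d + 1) / (d + 1) * torusSupNorm M (x' - x))) := by
  have htn : (c ν : ℕ) + t < n := by omega
  have ht₀n : (c ν : ℕ) + t₀ < n := by omega
  have hz := rayPt_eq_add_toT n M x' c ν t t₀ htn ht₀n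
  rw [rayPt, rayPt] at hz
  have hb := norm_dker_sub_le_rate n M μ lam ν x' x' x (rayOff n c ν t₀) (rayOff n c ν t) (rayVec ν t t₀) hz hα0 hα1
  rw [max_self] at hb
  rw [rayPt, rayPt]
  refine hb.trans ?_
  have hn : (0 : ℝ) < n := by exact_mod_cast Nat.pos_of_ne_zero (NeZero.ne n)
  have hE : 0 ≤ Real.exp (-(kappa163 (d + 1) / (d + 1) * torusSupNorm M (x' - x))) := (Real.exp_pos _).le
  have hρ : (supNorm (rayVec ν t t₀) / n) ^ α ≤ ((h : ℝ) / n) ^ α :=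
    Real.rpow_le_rpow (div_nonneg (supNorm_nonneg _) hn.le)
      (div_le_div_of_nonneg_right (supNorm_rayVec_le ν ht ht₀) hn.le) hα0
  exact mul_le_mul_of_nonneg_right (mul_le_mul_of_nonneg_left hρ (CHR_nonneg α)) hE

/-! ## §3 The gradient kernel against the secant slope of `H_k`, one level -/

/-- **THE ONE-LEVEL SECANT LAW FOR `∂_νH_k`** (every `n ≥ 1`, every torus, `d`-only constants apart from `α`): for an in-block ray
`P t = n·x̄′ + c + t·e_ν` (`c_ν + h < n`, `h ≥ 1`), every position `t₀ ≤ h` on it and `0 ≤ α < 1`,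
`‖∂_νH_n((P t₀, μ), (x̄, λ)) − (n∕h)·(H_n((P h, μ), (x̄, λ)) − H_n((P 0, μ), (x̄, λ)))‖ ≤ CHR(d,α)·(h∕n)^α·e^{−(κ₁₆₃(d+1)∕(d+1))·|x′−x|_T}`.
[cite: Balaban1984PropagatorsI, (1.63) p.28; p.29 lines 1–2 (the Hölder claim; typed torus form b05's)] [folklore] -/
theorem norm_dker_sub_secant_le (μ lam ν : Fin (d + 1)) (x' x : Fin (d + 1) → ℤ) (c : Fin (d + 1) → Fin n) {h : ℕ} (hh : 1 ≤ h)
    (hch : (c ν : ℕ) + h < n) {t₀ : ℕ} (ht₀ : t₀ ≤ h) {α : ℝ} (hα0 : 0 ≤ α) (hα1 : α < 1) :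
    ‖dker n M μ lam ν (rayPt n M x' c ν t₀) (toT M x)
        - (n : ℂ) / h * (hker n M μ lam (rayPt n M x' c ν h) (toT M x) - hker n M μ lam (rayPt n M x' c ν 0) (toT M x))‖
      ≤ CHR d α * ((h : ℝ) / n) ^ α * Real.exp (-(kappa163 (d + 1) / (d + 1) * torusSupNorm M (x' - x))) :=
  norm_sub_secant_le (fun t => hker n M μ lam (rayPt n M x' c ν t) (toT M x)) (fun t => dker n M μ lam ν (rayPt n M x' c ν t) (toT M x))
    (n : ℂ) hh t₀ (fun t ht => hker_ray_step n M μ lam ν x' x c t (by omega))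
    (fun t ht => norm_dker_ray_sub_le n M μ lam ν x' x c hch ht.le ht₀ hα0 hα1)

/-- the same with the `H_k` ENTRIES (`HkOp n M (X, μ) (ȳ, λ) = hker n M μ λ X ȳ` by definition). [folklore] -/
theorem norm_dker_sub_secant_HkOp_le (μ lam ν : Fin (d + 1)) (x' x : Fin (d + 1) → ℤ) (c : Fin (d + 1) → Fin n) {h : ℕ} (hh : 1 ≤ h)
    (hch : (c ν : ℕ) + h < n) {t₀ : ℕ} (ht₀ : t₀ ≤ h) {α : ℝ} (hα0 : 0 ≤ α) (hα1 : α < 1) :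
    ‖dker n M μ lam ν (rayPt n M x' c ν t₀) (toT M x)
        - (n : ℂ) / h * (HkOp n M (rayPt n M x' c ν h, μ) (toT M x, lam) - HkOp n M (rayPt n M x' c ν 0, μ) (toT M x, lam))‖
      ≤ CHR d α * ((h : ℝ) / n) ^ α * Real.exp (-(kappa163 (d + 1) / (d + 1) * torusSupNorm M (x' - x))) :=
  norm_dker_sub_secant_le n M μ lam ν x' x c hh hch ht₀ hα0 hα1

end Ray

end Summit.QuantumFields.BalabanUV.Beta.GAN24.HkGradientSecant

end
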